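import Summits.HubbardSuperconductivity.HubbardSuperconductivity.Theorems.BalabanIRBirComplexStableXYRCovarianceFRDMatrix
import Literature.MathematicalPhysics.QuantumFieldTheory.TorusChartCurlBound
import Mathlib.Algebra.Order.Chebyshev
import HarnessLib

/-!
# Crux `BirComplexStableXYR` (stmt-HubbardSuperconductivity-14845), line `fat-gaussian-defect-calculus`, chapter 1
# (lead c7): the thin Gaussian form is bounded on ALL real `1`-cochains — `𝒬_c(ω) ≤ 6 r⁵ · normA(c) · ‖ω‖²`

Support file (prover seat 1, route BalabanIR; item G2 "Coulomb strain" of lead c7's 10:55Z list, part (b): energies).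

Lead c7's summed window Hessian ("thin") form of a real `1`-cochain `ω` on `Λ L M = (Fin 2 → ZMod L) × ZMod M`
(registered stub `stub_thinFormCoercive`: LOWER bound `2c₀‖ω‖² ≤ 𝒬_c(ω)` under (N),(C)) evaluates the window Hessian
`−Re Σ_n c_n (n·v)²` on the staircase path sums `v_w` of `ω` inside each window.  This file proves the complementary
UPPER bound, valid for every table `c` with no hypothesis at all:

* `tfb_window_le` — per window, `Re(−Σ_n c_n (n·v)²) ≤ 2·normA(c)·Σ_w v_w²` (Cauchy–Schwarz `cfrd_form_sq_le` and
  `|n|₁² ≤ 2e^{|n|₁}`, as in `cfrd_form_le`);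
* `tfb_sum_pathSum_sq_le` — `Σ_s Σ_w v_{s,w}(ω)² ≤ 3 r⁵ ‖ω‖²` (each staircase has at most `r − 1 ≤ r` edges per
  direction; `(Σ_{k<n} θ_k)² ≤ n Σ θ_k²`; translation invariance of `Σ_s`);
* **`thinForm_le_normSq`** (registered stub of this seat on the crux item) — `𝒬_c(ω) ≤ 6 r⁵ normA(c) ‖ω‖²`.

With the landed square completion (`FSUnfolding.stub_coulombSquare` / `stub_bilinSquare`) and the Hodge decomposition of
`Literature/…/TorusChartHodgeDecomposition.lean` this gives the upper half of the Coulomb-gas sandwich for the strain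
`σ_a` of a vortex configuration: `𝒬_c(σ_a) ≤ 𝒬_c(2π(coexact (d₁ a) + harm₁ a)) ≤ 24π² r⁵ normA(c)·(½⟨d₁a, G d₁a⟩ + ‖harm₁ a‖²)`.

No definitions; sorry-free. [folklore]
-/

noncomputable section

namespace Summit.HubbardSuperconductivity.HubbardSuperconductivity.Theorems

set_option linter.dupNamespace false -- summit = problem name (single-conjunct summit), D-0017

open scoped BigOperators ComplexConjugate
open Complex Summit.HubbardSuperconductivity.BirComplexStableXYNegative
open Literature.Probability.LatticeModels Literature.MathematicalPhysics.QuantumFieldTheory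

section ThinFormBound

variable {r : ℕ} {L M : ℕ} [NeZero L] [NeZero M]

/-! ## The window bound -/

/-- `Σ_n ‖c_n‖ |n|₁² ≤ 2 normA(c)` (`x² ≤ 2eˣ`). [folklore] -/
theorem tfb_sum_norm_mul_sq_le (c : Table r) :
    c.sum (fun n a => ‖a‖ * (∑ w, |(n w : ℝ)|) ^ 2) ≤ 2 * normA c := by
  unfold normA
  rw [Finsupp.sum, Finsupp.sum, Finset.mul_sum]
  refine Finset.sum_le_sum fun n _ => ?_
  have := cfrd_sq_le_two_mul_exp (Finset.sum_nonneg fun w (_ : w ∈ Finset.univ) => abs_nonneg ((n w : ℝ)))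
  nlinarith [norm_nonneg (c n)]

/-- **Per-window upper bound of the real window Hessian** on an arbitrary window configuration `v`:
`Re(−Σ_n c_n (n·v)²) ≤ 2·normA(c)·Σ_w v_w²`. [folklore] -/
theorem tfb_window_le (c : Table r) (v : W r → ℝ) :
    (-c.sum (fun n a => a * (((∑ w : W r, (n w : ℝ) * v w) ^ 2 : ℝ) : ℂ))).re ≤ 2 * normA c * ∑ w, v w ^ 2 := by
  have h1 : (-c.sum (fun n a => a * (((∑ w : W r, (n w : ℝ) * v w) ^ 2 : ℝ) : ℂ))).re
      ≤ c.sum (fun n a => ‖a‖ * (∑ w, (n w : ℝ) * v w) ^ 2) := by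
    refine (Complex.re_le_norm _).trans ?_
    rw [norm_neg, Finsupp.sum, Finsupp.sum]
    refine (norm_sum_le _ _).trans (Finset.sum_le_sum fun n _ => ?_)
    rw [norm_mul, Complex.norm_real, Real.norm_eq_abs, abs_of_nonneg (sq_nonneg _)]
  have h2 : c.sum (fun n a => ‖a‖ * (∑ w, (n w : ℝ) * v w) ^ 2)
      ≤ c.sum (fun n a => ‖a‖ * ((∑ w, |(n w : ℝ)|) ^ 2 * ∑ w : W r, v w ^ 2)) := by
    rw [Finsupp.sum, Finsupp.sum]
    exact Finset.sum_le_sum fun n _ => mul_le_mul_of_nonneg_left (cfrd_form_sq_le n v) (norm_nonneg _)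
  have h3 : c.sum (fun n a => ‖a‖ * ((∑ w, |(n w : ℝ)|) ^ 2 * ∑ w : W r, v w ^ 2))
      = c.sum (fun n a => ‖a‖ * (∑ w, |(n w : ℝ)|) ^ 2) * ∑ w : W r, v w ^ 2 := by
    rw [Finsupp.sum, Finsupp.sum, Finset.sum_mul]
    exact Finset.sum_congr rfl fun n _ => by ring
  have h4 := tfb_sum_norm_mul_sq_le c
  have hv : 0 ≤ ∑ w : W r, v w ^ 2 := Finset.sum_nonneg fun w _ => sq_nonneg _
  calc _ ≤ _ := h1
    _ ≤ _ := h2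
    _ = _ := h3
    _ ≤ 2 * normA c * ∑ w, v w ^ 2 := mul_le_mul_of_nonneg_right h4 hv

/-! ## Staircase path sums are `ℓ²`-bounded -/

/-- A line sum of `n` edges, squared, is at most `n` times the sum of the squared edges (Cauchy–Schwarz). [folklore] -/
theorem tfb_lineSum_sq_le {Λ' : Type} [AddCommGroup Λ'] {d : ℕ} (F : TorusChart Λ' d) (θ : Λ' → Fin d → ℝ)
    (i : Fin d) (n : ℕ) (y : Λ') :
    (F.lineSum θ i n y) ^ 2 ≤ n * ∑ k ∈ Finset.range n, (θ (y + k • F.gen i) i) ^ 2 := by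
  have h := sq_sum_le_card_mul_sum_sq (s := Finset.range n) (f := fun k : ℕ => θ (y + k • F.gen i) i)
  rw [Finset.card_range] at h
  exact h

/-- Summing the squared edges of a line of `n` edges over all base points gives `n‖θ_i‖²` (translation invariance).
[folklore] -/
theorem tfb_sum_sum_range_sq {Λ' : Type} [AddCommGroup Λ'] [Fintype Λ'] {d : ℕ} (F : TorusChart Λ' d)
    (θ : Λ' → Fin d → ℝ) (i : Fin d) (n : ℕ) (v : Λ') :
    ∑ y : Λ', ∑ k ∈ Finset.range n, (θ (y + v + k • F.gen i) i) ^ 2 = n * ∑ y : Λ', (θ y i) ^ 2 := by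
  rw [Finset.sum_comm]
  have : ∀ k ∈ Finset.range n, ∑ y : Λ', (θ (y + v + k • F.gen i) i) ^ 2 = ∑ y : Λ', (θ y i) ^ 2 := by
    intro k _
    simp only [add_assoc]
    exact TorusChart.sum_comp_add_eq (fun y => (θ y i) ^ 2) (v + k • F.gen i)
  rw [Finset.sum_congr rfl this, Finset.sum_const, Finset.card_range, nsmul_eq_mul]

/-- Sum over base points of a squared line sum of `n ≤ r` edges: `Σ_y L_i(n; y + v)² ≤ r² ‖θ_i‖²`. [folklore] -/
theorem tfb_sum_lineSum_sq_le {Λ' : Type} [AddCommGroup Λ'] [Fintype Λ'] {d : ℕ} (F : TorusChart Λ' d)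
    (θ : Λ' → Fin d → ℝ) (i : Fin d) {n : ℕ} (hn : n ≤ r) (v : Λ') :
    ∑ y : Λ', (F.lineSum θ i n (y + v)) ^ 2 ≤ (r : ℝ) ^ 2 * ∑ y : Λ', (θ y i) ^ 2 := by
  calc ∑ y : Λ', (F.lineSum θ i n (y + v)) ^ 2
      ≤ ∑ y : Λ', (n * ∑ k ∈ Finset.range n, (θ (y + v + k • F.gen i) i) ^ 2) :=
        Finset.sum_le_sum fun y _ => tfb_lineSum_sq_le F θ i n (y + v)
    _ = n * (n * ∑ y : Λ', (θ y i) ^ 2) := by rw [← Finset.mul_sum, tfb_sum_sum_range_sq]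
    _ ≤ (r : ℝ) ^ 2 * ∑ y : Λ', (θ y i) ^ 2 := by
        have hs : 0 ≤ ∑ y : Λ', (θ y i) ^ 2 := Finset.sum_nonneg fun y _ => sq_nonneg _
        have hn' : (n : ℝ) ≤ r := by exact_mod_cast hn
        have hn0 : (0 : ℝ) ≤ n := Nat.cast_nonneg n
        rw [← mul_assoc, sq]
        exact mul_le_mul_of_nonneg_right (mul_le_mul hn' hn' hn0 (Nat.cast_nonneg r)) hs

/-- **The staircase path sums of a `1`-cochain are `ℓ²`-bounded**:
`Σ_s Σ_w v_{s,w}(ω)² ≤ 3 r⁵ Σ_{x,i} ω(x,i)²` on the space–time torus (three directions, at most `r − 1 ≤ r` edges per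
direction, `r³` windows positions `w`). [folklore] -/
theorem tfb_sum_pathSum_sq_le (ω : Λ L M → Fin 3 → ℝ) :
    ∑ s : Λ L M, ∑ w : W r,
        ((TorusChart.piProdZMod 2 L M).lineSum ω 0 (w.1 : ℕ) s
          + (TorusChart.piProdZMod 2 L M).lineSum ω 1 (w.2.1 : ℕ) (s + (w.1 : ℕ) • (TorusChart.piProdZMod 2 L M).gen 0)
          + (TorusChart.piProdZMod 2 L M).lineSum ω 2 (w.2.2 : ℕ)
              (s + (w.1 : ℕ) • (TorusChart.piProdZMod 2 L M).gen 0 + (w.2.1 : ℕ) • (TorusChart.piProdZMod 2 L M).gen 1)) ^ 2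
      ≤ 3 * (r : ℝ) ^ 5 * ∑ x : Λ L M, ∑ i : Fin 3, (ω x i) ^ 2 := by
  set F := TorusChart.piProdZMod 2 L M with hF
  rw [Finset.sum_comm]
  -- per window position `w`
  have hw : ∀ w : W r, ∑ s : Λ L M,
      (F.lineSum ω 0 (w.1 : ℕ) s + F.lineSum ω 1 (w.2.1 : ℕ) (s + (w.1 : ℕ) • F.gen 0)
        + F.lineSum ω 2 (w.2.2 : ℕ) (s + (w.1 : ℕ) • F.gen 0 + (w.2.1 : ℕ) • F.gen 1)) ^ 2
      ≤ 3 * (r : ℝ) ^ 2 * ∑ x : Λ L M, ∑ i : Fin 3, (ω x i) ^ 2 := by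
    intro w
    have h0 := tfb_sum_lineSum_sq_le (r := r) F ω 0 (n := (w.1 : ℕ)) w.1.isLt.le 0
    have h1 := tfb_sum_lineSum_sq_le (r := r) F ω 1 (n := (w.2.1 : ℕ)) w.2.1.isLt.le ((w.1 : ℕ) • F.gen 0)
    have h2 := tfb_sum_lineSum_sq_le (r := r) F ω 2 (n := (w.2.2 : ℕ)) w.2.2.isLt.le
      ((w.1 : ℕ) • F.gen 0 + (w.2.1 : ℕ) • F.gen 1)
    simp only [add_zero] at h0
    simp only [← add_assoc] at h2
    calc ∑ s : Λ L M, (F.lineSum ω 0 (w.1 : ℕ) s + F.lineSum ω 1 (w.2.1 : ℕ) (s + (w.1 : ℕ) • F.gen 0)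
            + F.lineSum ω 2 (w.2.2 : ℕ) (s + (w.1 : ℕ) • F.gen 0 + (w.2.1 : ℕ) • F.gen 1)) ^ 2
        ≤ ∑ s : Λ L M, 3 * ((F.lineSum ω 0 (w.1 : ℕ) s) ^ 2 + (F.lineSum ω 1 (w.2.1 : ℕ) (s + (w.1 : ℕ) • F.gen 0)) ^ 2
            + (F.lineSum ω 2 (w.2.2 : ℕ) (s + (w.1 : ℕ) • F.gen 0 + (w.2.1 : ℕ) • F.gen 1)) ^ 2) :=
          Finset.sum_le_sum fun s _ => by
            nlinarith [sq_nonneg (F.lineSum ω 0 (w.1 : ℕ) s - F.lineSum ω 1 (w.2.1 : ℕ) (s + (w.1 : ℕ) • F.gen 0)),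
              sq_nonneg (F.lineSum ω 0 (w.1 : ℕ) s
                - F.lineSum ω 2 (w.2.2 : ℕ) (s + (w.1 : ℕ) • F.gen 0 + (w.2.1 : ℕ) • F.gen 1)),
              sq_nonneg (F.lineSum ω 1 (w.2.1 : ℕ) (s + (w.1 : ℕ) • F.gen 0)
                - F.lineSum ω 2 (w.2.2 : ℕ) (s + (w.1 : ℕ) • F.gen 0 + (w.2.1 : ℕ) • F.gen 1))]
      _ = 3 * (∑ s : Λ L M, (F.lineSum ω 0 (w.1 : ℕ) s) ^ 2
            + ∑ s : Λ L M, (F.lineSum ω 1 (w.2.1 : ℕ) (s + (w.1 : ℕ) • F.gen 0)) ^ 2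
            + ∑ s : Λ L M, (F.lineSum ω 2 (w.2.2 : ℕ) (s + (w.1 : ℕ) • F.gen 0 + (w.2.1 : ℕ) • F.gen 1)) ^ 2) := by
          rw [← Finset.mul_sum, Finset.sum_add_distrib, Finset.sum_add_distrib]
      _ ≤ 3 * ((r : ℝ) ^ 2 * ∑ x : Λ L M, (ω x 0) ^ 2 + (r : ℝ) ^ 2 * ∑ x : Λ L M, (ω x 1) ^ 2
            + (r : ℝ) ^ 2 * ∑ x : Λ L M, (ω x 2) ^ 2) := by
          gcongr
      _ = 3 * (r : ℝ) ^ 2 * ∑ x : Λ L M, ∑ i : Fin 3, (ω x i) ^ 2 := by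
          simp only [Fin.sum_univ_three, Finset.sum_add_distrib]
          ring
  calc ∑ w : W r, ∑ s : Λ L M,
        (F.lineSum ω 0 (w.1 : ℕ) s + F.lineSum ω 1 (w.2.1 : ℕ) (s + (w.1 : ℕ) • F.gen 0)
          + F.lineSum ω 2 (w.2.2 : ℕ) (s + (w.1 : ℕ) • F.gen 0 + (w.2.1 : ℕ) • F.gen 1)) ^ 2
      ≤ ∑ w : W r, 3 * (r : ℝ) ^ 2 * ∑ x : Λ L M, ∑ i : Fin 3, (ω x i) ^ 2 := Finset.sum_le_sum fun w _ => hw w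
    _ = 3 * (r : ℝ) ^ 5 * ∑ x : Λ L M, ∑ i : Fin 3, (ω x i) ^ 2 := by
        rw [Finset.sum_const, Finset.card_univ, nsmul_eq_mul]
        have hc : (Fintype.card (W r) : ℝ) = (r : ℝ) ^ 3 := by
          simp only [W, Fintype.card_prod, Fintype.card_fin]; push_cast; ring
        rw [hc]; ring

/-! ## The upper bound of the thin form -/

/-- **The thin Gaussian form is bounded on all real `1`-cochains** (registered stub `thinForm_le_normSq` of prover
seat 1 on stmt-HubbardSuperconductivity-14845; item G2(b) of lead c7's chapter 1): for EVERY table `c` (no hypothesis)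
and every real `1`-cochain `ω` on `Λ L M`, lead c7's summed window Hessian form satisfies
`𝒬_c(ω) ≤ 6 r⁵ · normA(c) · Σ_{x,i} ω(x,i)²`.  (Companion of the lower bound `stub_thinFormCoercive`
`2c₀‖ω‖² ≤ 𝒬_c(ω)` under (N),(C); on exact cochains `ω = d₀φ` it is `cfrd_form_le`, `H_c ≤ 2·normA·r³`.) [folklore] -/
theorem thinForm_le_normSq : ∀ (r : ℕ) (c : Table r) (L M : ℕ) [NeZero L] [NeZero M] (ω : Λ L M → Fin 3 → ℝ), (∑ s : Λ L M, (-c.sum (fun n a => a * (((∑ w : W r, (n w : ℝ) * ((Literature.MathematicalPhysics.QuantumFieldTheory.TorusChart.piProdZMod 2 L M).lineSum ω 0 (w.1 : ℕ) s + (Literature.MathematicalPhysics.QuantumFieldTheory.TorusChart.piProdZMod 2 L M).lineSum ω 1 (w.2.1 : ℕ) (s + (w.1 : ℕ) • (Literature.MathematicalPhysics.QuantumFieldTheory.TorusChart.piProdZMod 2 L M).gen 0) + (Literature.MathematicalPhysics.QuantumFieldTheory.TorusChart.piProdZMod 2 L M).lineSum ω 2 (w.2.2 : ℕ) (s + (w.1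 : ℕ) • (Literature.MathematicalPhysics.QuantumFieldTheory.TorusChart.piProdZMod 2 L M).gen 0 + (w.2.1 : ℕ) • (Literature.MathematicalPhysics.QuantumFieldTheory.TorusChart.piProdZMod 2 L M).gen 1))) ^ 2 : ℝ) : ℂ))).re) ≤ 6 * (r : ℝ) ^ 5 * normA c * ∑ x : Λ L M, ∑ i : Fin 3, (ω x i) ^ 2 := by
  intro r c L M _ _ ω
  have hA := normA_nonneg c
  calc _ ≤ ∑ s : Λ L M, 2 * normA c * ∑ w : W r,
          ((TorusChart.piProdZMod 2 L M).lineSum ω 0 (w.1 : ℕ) s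
            + (TorusChart.piProdZMod 2 L M).lineSum ω 1 (w.2.1 : ℕ) (s + (w.1 : ℕ) • (TorusChart.piProdZMod 2 L M).gen 0)
            + (TorusChart.piProdZMod 2 L M).lineSum ω 2 (w.2.2 : ℕ)
                (s + (w.1 : ℕ) • (TorusChart.piProdZMod 2 L M).gen 0
                  + (w.2.1 : ℕ) • (TorusChart.piProdZMod 2 L M).gen 1)) ^ 2 :=
        Finset.sum_le_sum fun s _ => tfb_window_le c _
    _ = 2 * normA c * ∑ s : Λ L M, ∑ w : W r,
          ((TorusChart.piProdZMod 2 L M).lineSum ω 0 (w.1 : ℕ) s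
            + (TorusChart.piProdZMod 2 L M).lineSum ω 1 (w.2.1 : ℕ) (s + (w.1 : ℕ) • (TorusChart.piProdZMod 2 L M).gen 0)
            + (TorusChart.piProdZMod 2 L M).lineSum ω 2 (w.2.2 : ℕ)
                (s + (w.1 : ℕ) • (TorusChart.piProdZMod 2 L M).gen 0
                  + (w.2.1 : ℕ) • (TorusChart.piProdZMod 2 L M).gen 1)) ^ 2 := by rw [Finset.mul_sum]
    _ ≤ 2 * normA c * (3 * (r : ℝ) ^ 5 * ∑ x : Λ L M, ∑ i : Fin 3, (ω x i) ^ 2) :=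
        mul_le_mul_of_nonneg_left (tfb_sum_pathSum_sq_le ω) (by positivity)
    _ = 6 * (r : ℝ) ^ 5 * normA c * ∑ x : Λ L M, ∑ i : Fin 3, (ω x i) ^ 2 := by ring

end ThinFormBound

end Summit.HubbardSuperconductivity.HubbardSuperconductivity.Theorems

end
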